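import Summits.BirchSwinnertonDyer.BirchSwinnertonDyer.Theorems.ByReductionTypeAtTwoSupersingularFlatKernelCyclicOfQuotientDual
import Summits.BirchSwinnertonDyer.BirchSwinnertonDyer.Theorems.ByReductionTypeAtTwoSupersingularFlatNoFiniteSubmoduleOfClassical
import Summits.BirchSwinnertonDyer.Rank1Residual.F1Sign2.HondaSystemAtTwo
import HarnessLib

/-!
# Route `ByReductionTypeAtTwo` (rung K4), crux `SupersingularRankZeroAtTwo` (item stmt-BirchSwinnertonDyer-19097), line `odd_blind_package`
# v2.13 (04fc80b988a3bb5c), stub 5 `stub_flatKernelCyclic : FlatKernelCyclicHondaAtTwo` (hand h13): **the registered h13 signature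
# (LEAD memo `HAND-TARGETS-NF-1.md` §2 / pen cert `plan/gen39/ACCEPTANCE-SHAPES-h13.lean` @c404740f150d9c56, VERBATIM) from ONE displayed
# family — «`Hom(Sel_∞ ⧸ Sel♭, ℚ/ℤ)` is a cyclic `Λ`-module» under the stub's own antecedents** (cell `bsd-2adic`, seat `bsd-2adic-t42`
# GEN 44, hand h13 sub-hand h13b; `--supports 19097`, helper; sequel of `…FlatKernelCyclicOfQuotientDual`)

HONEST FRAMING (D-0036/D-0054): THEOREM ONLY (no definition, no named fact, no `sorry`, no instance).  `stub_flatKernelCyclic` is NOT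
closed: the displayed family `hcyc` — for every datum of the stub (same binders through the Honda clause), the Pontryagin dual of
`Sel_{2^∞}(E/ℚ_∞) ⧸ Sel♭(E/ℚ_∞)` with `T = conj_γ − 1` is cyclic — is the ARITHMETIC content of h13b (Kitajima–Otsuki (4.2) + Prop. 3.32
for Sprung's ♭ at `p = 2`: the Kummer pairing against `z♭` embeds `Sel/Sel♭` into `(Ker Col♭)^∨ ≅ Λ^∨`; with h13a = `Ker Col♭ = Λ ∙ z♭`,
LEAD ★★ p824030 modulo `e : H¹_Iw ≃ₗ Λ²`) and is NOT proved here.  What the theorem records: GIVEN that family, the stub follows for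
every `D`, `S`, `π` — the torsion of `X♭`, the finiteness instances and the classical dual enter only through the pinning identity.
19097 OPEN; nothing booked; BSD proved for no curve; typed ≠ proved.

References: [KitajimaOtsuki2018] (4.2), Prop. 3.32; [Sprung2012] Def. 7.9, 7.11; [GreenbergLNM1716] §1 p. 60; tree p823268, `…FlatKernelCyclicOfQuotientDual`.
-/

set_option autoImplicit false
-- the Theorems namespace of this sub repeats the summit name by design (D-0017 nested layout)
set_option linter.dupNamespace false

noncomputable section

open scoped Classical NumberField
open NumberField IsDedekindDomain WeierstrassCurve Literature.NumberTheory.EllipticCurves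
  Literature.NumberTheory.EllipticCurves.Sprung2017 Literature.NumberTheory.EllipticCurves.Sprung2012
  Literature.NumberTheory.EllipticCurves.Rank1Residual Literature.NumberTheory.EllipticCurves.Rank1Residual.Typed
  Literature.NumberTheory.EllipticCurves.Kobayashi2003 Literature.NumberTheory.EllipticCurves.IwasawaDual
  Literature.NumberTheory.GaloisRepresentations
  ZpExtension Summit.BirchSwinnertonDyer.Rank1Residual Summit.BirchSwinnertonDyer.Rank1Residual.Supersingular

namespace Summit.BirchSwinnertonDyer.BirchSwinnertonDyer.Theorems.OddBlindNF

/-- **h13 `FlatKernelCyclicHondaAtTwo` (v2.13 stub 5, signature VERBATIM) from the cyclicity of `Hom(Sel_∞ ⧸ Sel♭, ℚ/ℤ)`.**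
The hypothesis `hcyc` carries the stub's binders through the Honda clause and concludes, for the ONE discrete group
`Q = Sel_{2^∞}(E/ℚ_∞) ⧸ Sel♭(E/ℚ_∞)` (Sprung's ♭ condition at the place of `ℚ_∞` over `2`, key `g`, Honda datum `c`), that the
`Λ = ℤ₂⟦T⟧`-module `Hom(Q, ℚ/ℤ)` (`T = conj_γ − 1`, structure `IsLocNil.module` of `isLocNil_quotient_sharpFlat`) is generated by one
element.  Conclusion: the kernel of every pinned `π : X ↠ X♭` is cyclic (`exists_ker_eq_span_singleton_of_cyclic_quotientDual`).
CONDITIONAL on `hcyc` (Kitajima–Otsuki (4.2) + Prop. 3.32 for ♭ at 2; not in the tree). [cite: KitajimaOtsuki2018, (4.2) and Prop. 3.32 (arXiv:1607.03612 pp. 16, 19)]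
[cite: Sprung2012, Def. 7.9, Def. 7.11] -/
theorem flatKernelCyclic_honda_two_of_cyclic_quotientDual
    (hcyc :
      ∀ (W : WeierstrassCurve ℚ) [W.IsElliptic] [W.IsGloballyMinimal], GoodSS W 2 →
        ∀ (κ : ZpExtension ℚ 2) (γ : Field.absoluteGaloisGroup ℚ),
          κ.IsCyclotomic → κ.IsTopGenerator γ → IsCyclotomicVariable 2 γ →
        ∀ (v : HeightOneSpectrum (𝓞 ℚ)), (2 : 𝓞 ℚ) ∈ v.asIdeal →
        ∀ (g : Field.absoluteGaloisGroup (v.adicCompletion ℚ)) (c : ℕ → localPoints W (v.adicCompletion ℚ)),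
          κ.IsTopGenerator (resGalOfEmb (closureEmb (K := ℚ) (v.adicCompletion ℚ)) g) →
          (∀ n, c n ∈ localLayerPointsOfEmb κ (closureEmb (K := ℚ) (v.adicCompletion ℚ)) W n) →
          (∀ n, 1 ≤ n → localTraceOfEmb κ (closureEmb (K := ℚ) (v.adicCompletion ℚ)) W n (n + 1)
            (c (n + 1)) = W.frobeniusTrace 2 • c n - c (n - 1)) →
          (∀ z₀ : localLayerPointsOfEmb κ (closureEmb (K := ℚ) (v.adicCompletion ℚ)) W 0 →+ ℤ_[2],
            evalOn W (localLayerPointsOfEmb κ (closureEmb (K := ℚ) (v.adicCompletion ℚ)) W 0) z₀ (c 0) = 0 → z₀ = 0) →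
          (∀ a : ℤ_[2],
            (∃ z₀ : localLayerPointsOfEmb κ (closureEmb (K := ℚ) (v.adicCompletion ℚ)) W 0 →+ ℤ_[2],
              evalOn W (localLayerPointsOfEmb κ (closureEmb (K := ℚ) (v.adicCompletion ℚ)) W 0) z₀ (c 0) = 2 * a) →
            ∃ y : localLayerPointsOfEmb κ (closureEmb (K := ℚ) (v.adicCompletion ℚ)) W 0 →+ ℤ_[2],
              evalOn W (localLayerPointsOfEmb κ (closureEmb (K := ℚ) (v.adicCompletion ℚ)) W 0) y (c 0) = a) →
          (∃ cneg : localPoints W (v.adicCompletion ℚ),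
            Summit.BirchSwinnertonDyer.Rank1Residual.F1Sign2.IsHondaSystemAtTwo κ (closureEmb (K := ℚ) (v.adicCompletion ℚ)) W
              (W.frobeniusTrace 2) g cneg c) →
        letI := (isLocNil_quotient_sharpFlat (W := W) (κ := κ) (ι := closureEmb (K := ℚ) (v.adicCompletion ℚ))
          (ap := W.frobeniusTrace 2) (g := g) (c := c) (col := .flat) γ).module (A := AddCircle (1 : ℚ));
        ∃ y₀ : W.selmerInfty κ ⧸ (sharpFlatSelmerInfty W κ (closureEmb (K := ℚ) (v.adicCompletion ℚ)) (W.frobeniusTrace 2) g c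
            .flat).addSubgroupOf (W.selmerInfty κ) →+ AddCircle (1 : ℚ),
          ∀ y, ∃ f : IwasawaAlgebra 2, f • y₀ = y) :
    ∀ (W : WeierstrassCurve ℚ) [W.IsElliptic] [W.IsGloballyMinimal], GoodSS W 2 →
      ∀ (κ : ZpExtension ℚ 2) (γ : Field.absoluteGaloisGroup ℚ),
        κ.IsCyclotomic → κ.IsTopGenerator γ → IsCyclotomicVariable 2 γ →
      ∀ (v : HeightOneSpectrum (𝓞 ℚ)), (2 : 𝓞 ℚ) ∈ v.asIdeal →
      ∀ (g : Field.absoluteGaloisGroup (v.adicCompletion ℚ)) (c : ℕ → localPoints W (v.adicCompletion ℚ)),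
        κ.IsTopGenerator (resGalOfEmb (closureEmb (K := ℚ) (v.adicCompletion ℚ)) g) →
        (∀ n, c n ∈ localLayerPointsOfEmb κ (closureEmb (K := ℚ) (v.adicCompletion ℚ)) W n) →
        (∀ n, 1 ≤ n → localTraceOfEmb κ (closureEmb (K := ℚ) (v.adicCompletion ℚ)) W n (n + 1)
          (c (n + 1)) = W.frobeniusTrace 2 • c n - c (n - 1)) →
        (∀ z₀ : localLayerPointsOfEmb κ (closureEmb (K := ℚ) (v.adicCompletion ℚ)) W 0 →+ ℤ_[2],
          evalOn W (localLayerPointsOfEmb κ (closureEmb (K := ℚ) (v.adicCompletion ℚ)) W 0) z₀ (c 0) = 0 → z₀ = 0) →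
        (∀ a : ℤ_[2],
          (∃ z₀ : localLayerPointsOfEmb κ (closureEmb (K := ℚ) (v.adicCompletion ℚ)) W 0 →+ ℤ_[2],
            evalOn W (localLayerPointsOfEmb κ (closureEmb (K := ℚ) (v.adicCompletion ℚ)) W 0) z₀ (c 0) = 2 * a) →
          ∃ y : localLayerPointsOfEmb κ (closureEmb (K := ℚ) (v.adicCompletion ℚ)) W 0 →+ ℤ_[2],
            evalOn W (localLayerPointsOfEmb κ (closureEmb (K := ℚ) (v.adicCompletion ℚ)) W 0) y (c 0) = a) →
        (∃ cneg : localPoints W (v.adicCompletion ℚ),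
          Summit.BirchSwinnertonDyer.Rank1Residual.F1Sign2.IsHondaSystemAtTwo κ (closureEmb (K := ℚ) (v.adicCompletion ℚ)) W
            (W.frobeniusTrace 2) g cneg c) →
      ∀ (D : SharpFlatSelmerDualData W κ γ (closureEmb (K := ℚ) (v.adicCompletion ℚ))
          (W.frobeniusTrace 2) g c .flat) [Module.Finite (IwasawaAlgebra 2) D.X],
        Module.IsTorsion (IwasawaAlgebra 2) D.X →
      ∀ (S : W.SelmerDualData κ γ) [Module.Finite (IwasawaAlgebra 2) S.X]
        (π : S.X →ₗ[IwasawaAlgebra 2] D.X),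
        (∀ (x : S.X) (s : sharpFlatSelmerInfty W κ (closureEmb (K := ℚ) (v.adicCompletion ℚ)) (W.frobeniusTrace 2) g c .flat),
          D.toDual (π x) s = S.toDual x (AddSubgroup.inclusion
            (sharpFlatSelmerInfty_le_selmerInfty W κ (closureEmb (K := ℚ) (v.adicCompletion ℚ)) (W.frobeniusTrace 2) g c .flat) s)) →
        ∃ x₀ : S.X, LinearMap.ker π = Submodule.span (IwasawaAlgebra 2) {x₀} := by
  intro W _ _ hss κ γ hκ hγ hcv v hv g c hg hc htr hz hsat hH D _ _ S _ π hpin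
  exact exists_ker_eq_span_singleton_of_cyclic_quotientDual S D π hpin
    (hcyc W hss κ γ hκ hγ hcv v hv g c hg hc htr hz hsat hH)

end Summit.BirchSwinnertonDyer.BirchSwinnertonDyer.Theorems.OddBlindNF

end
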